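import Summits.BirchSwinnertonDyer.BirchSwinnertonDyer.Theorems.SemiOrdinaryEisensteinDescentShaTwoCochainShell
import Summits.BirchSwinnertonDyer.BirchSwinnertonDyer.Theorems.SemiOrdinaryEisensteinDescentShaTwoCochainBridgeSum
import Summits.BirchSwinnertonDyer.BirchSwinnertonDyer.Theorems.SemiOrdinaryEisensteinDescentShaTwoCochainClassReadout
import Summits.BirchSwinnertonDyer.BirchSwinnertonDyer.Theorems.ThetaPartnerAtTwoSignedControlAtTwoShaThreeBaseH3Units
import Literature.NumberTheory.GaloisRepresentations.ContinuousH2OrderTwo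
import Literature.NumberTheory.GaloisRepresentations.LocalDualityTheorem
import HarnessLib

/-!
# Milne I Thm. 4.10 (a) for `Ш²(K, E[m])` in cochain form — the input `hPTc` of the tree's Cassels–Tate recipe — at EVERY level
# over a TOTALLY COMPLEX number field (e.g. a Heegner field), for THE canonical invariant maps

Route `GenusKolyvaginAtTwo`, crux `KolyvaginExactAtTwo` (stmt-BirchSwinnertonDyer-22137) → Q3-inner, Cassels–Tate block at the
EVEN level; seat `bsd-line-gk2-p2` g13 (cell `bsd-f1-sign2`), `--supports 22137`, helper. THEOREMS ONLY (no definition, no named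
fact, no `sorry`, no instance).

Cell `bsd-wall`'s Ш²-cochain bridge (memo `Cruxes/WildKolyvaginUpperAtThree/SHA2-BRIDGE-w3g7.md`, 30+ files
`Theorems/SemiOrdinaryEisensteinDescentShaTwoCochain*.lean`) discharges `hPTc` — «for a `2`-cocycle `f` of `E[m]`: if for every
locally trivial `1`-cocycle `g` there is an admissible Poitou–Tate choice whose canonical local terms are finitely supported and sum
to zero, then `[f] = 0`» — at the ODD prime-power levels (item stmt-BirchSwinnertonDyer-20191, closed). Oddness is used at exactly
three places: `H³(K, μ_{m²}) = 0` outright (`cd_p Γ_K ≤ 2`, `p ≠ 2`); the archimedean members of THE canonical family vanish on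
`m²`-torsion classes; the archimedean local classes of the bridge's idèle cocycle vanish (`m²`-torsion and `2`-torsion). Over a
TOTALLY COMPLEX `K` all three hold at EVERY level for the trivial reason that `Γ_{K_w} = 1` at a complex place:

* §1 `galoisCohomology_three_eq_zero_of_isTotallyComplex'` (Milne I 4.10 (c)₃, the tree's
  `ShaThreeBrauer.poitouTate_three_realPlaces_injective_holds`, no real places), `twoCocycleClass_units_eq_zero_of_isComplex`
  (`H²(K_w, K̄_wˣ) = 0` at a complex place);
* §2 `exists_bridge_sum_localInvariants_eq_zero_of_isTotallyComplex` — w3 g7's bridge sum WITHOUT `m` odd;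
* §3 `readout_eq_zero_of_isTotallyComplex` — w4 g2's `hbridge_of_readout_criterion` WITHOUT `p ≠ 2`, for ANY `E/K` (not only base
  changes) and any level, fed by w3 g8's `ShaTwoCochain.classBarInv_readout_eq_zero_of_criterion`;
* §4 **`hPTc_canonical_of_isTotallyComplex`** — `hPTc` for `LocalInvariants.canonical K (m·m)`, EVERY `m ≥ 1`, every elliptic
  `E/K`, `K` totally complex: the Shell's exhaustion + readout-vanishing (`PTChoice.twoCocycleClass_eq_zero_of_shaTwoConnecting_eq_zero_flip`,
  `shaTwoConnecting_eq_zero_of_forall_sha_classBarInv_extOneEquiv_symm_eq_zero`) composed with §3.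

With `CasselsTateAnyLevel.lemma615Input_canonical` (h615 at every level, this seat) this leaves Cassels' ALTERNATION `hct_alt` as the
ONLY input of `isLevelPairing_ctLevelPairing_of_inputs` at the `2`-power levels over a totally complex field (sequel file
`…CasselsTateLevelPairingTotallyComplex`). BSD is not proved by any of this.

References: [MilneADT2006] I Thm. 4.10 (a)(c), Lemma 4.13, §6 Prop. 6.9, Thm. 6.13 (a); [CasselsFrohlichANT1967] Ch. VII §11.2 (bis);
[SerreGaloisCohomology1997] I §2.4.
-/

noncomputable section

open scoped Classical

-- the Theorems namespace of this sub repeats the summit name by design (D-0017 nested layout)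
set_option linter.dupNamespace false
set_option autoImplicit false

namespace Summit.BirchSwinnertonDyer.BirchSwinnertonDyer.Theorems.GenusExact.CasselsTatePTc

open CategoryTheory _root_.WeierstrassCurve Field Function NumberField IsDedekindDomain
open Literature.NumberTheory.EllipticCurves
open Literature.NumberTheory.GaloisRepresentations Literature.NumberTheory.GaloisRepresentations.HomDual
  Literature.NumberTheory.GaloisCohomology
open Literature.Algebra.Homology Literature.Algebra.Homology.DiscreteRep ContRepresentation Literature
open Literature.NumberTheory.GaloisRepresentations.DiscreteGaloisModule (units UnitsCarrier mu MuCarrier TateDual tateDual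
  tateDualPairing pairingDualHom pairingDualIntertwining sha shaTwo)
open Literature.NumberTheory.GaloisRepresentations.IdeleClassBar (classBarD classBarInv)
open Literature.NumberTheory.GaloisRepresentations.FreePresentation
open Literature.NumberTheory.GaloisRepresentations.DGMBridge
open Literature.NumberTheory.GaloisRepresentations.OpenLayer (extOneEquiv)
open Literature.Algebra.Homology.ExtPresentation
open Literature.AnabelianGeometry.AbsoluteAnabelian (Prop121vii.brauerInvariantEquiv Prop121vii.zmodToQmodZ)
open Summit.BirchSwinnertonDyer.BirchSwinnertonDyer.Theorems.ShaTwoCochain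
open Summit.BirchSwinnertonDyer.BirchSwinnertonDyer.Theorems.ShaTwoCochainTheta
open Summit.BirchSwinnertonDyer.BirchSwinnertonDyer.Theorems.SchneiderFreeAdditiveX3.PoitouTateReduction (exists_bidual_intertwining)
open scoped ContRepresentation NumberField

/-! ## §1 No real places: `H³(K, M) = 0` and `H²(K_w, K̄_wˣ) = 0` -/

section NoRealPlaces

variable (K : Type) [Field K] [NumberField K]

/-- **Over a totally complex number field `H³(K, M) = 0`** for every finite discrete `Γ_K`-module `M` (Milne I Thm. 4.10 (c): the tree's
`ShaThreeBrauer.poitouTate_three_realPlaces_injective_holds`, and there are no real places). [cite: MilneADT2006, Ch. I, Thm. 4.10 (c)] -/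
theorem galoisCohomology_three_eq_zero_of_isTotallyComplex' [IsTotallyComplex K] {M : Type} [AddCommGroup M]
    [TopologicalSpace M] [DiscreteTopology M] [Finite M] (ρ : DiscreteGaloisModule K M) (c : galoisCohomology ρ 3) : c = 0 :=
  SignedEC.ShaThreeBrauer.poitouTate_three_realPlaces_injective_holds K M ρ c fun w hw =>
    absurd hw (InfinitePlace.not_isReal_iff_isComplex.2 (IsTotallyComplex.isComplex w))

/-- `H³(K, μ_n) = 0` over a totally complex number field, every level `n`. [cite: MilneADT2006, Ch. I, Thm. 4.10 (c)] -/
theorem galoisCohomology_three_mu_eq_zero_of_isTotallyComplex' [IsTotallyComplex K] (n : ℕ) [NeZero n]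
    (c : galoisCohomology (mu K n) 3) : c = 0 := by
  haveI : Finite (MuCarrier K n) := finite_muCarrier K n
  exact galoisCohomology_three_eq_zero_of_isTotallyComplex' K (mu K n) c

variable {K} in
/-- **At a complex place every class of `H²(K_w, X)` vanishes** (`Γ_{K_w} = 1`). [cite: SerreGaloisCohomology1997, I §2.4] -/
theorem twoCocycleClass_eq_zero_of_isComplex (w : InfinitePlace K) (hw : w.IsComplex)
    (X : TopRep.{0} ℤ (absoluteGaloisGroup (Place.Completion (Sum.inl w : Place K))))
    (c : haveI := absoluteGaloisGroup_compactSpace (Place.Completion (Sum.inl w : Place K)); contTwoCocycles X) :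
    haveI := absoluteGaloisGroup_compactSpace (Place.Completion (Sum.inl w : Place K))
    twoCocycleClass X c = 0 := by
  haveI := absoluteGaloisGroup_compactSpace (Place.Completion (Sum.inl w : Place K))
  haveI : Subsingleton (absoluteGaloisGroup (Place.Completion (Sum.inl w : Place K))) :=
    ⟨fun a b => (eq_one_absoluteGaloisGroup_of_isComplex (K := K) hw a).trans
      (eq_one_absoluteGaloisGroup_of_isComplex (K := K) hw b).symm⟩
  exact continuousCohomology_two_eq_zero_of_subsingleton X _

end NoRealPlaces

/-! ## §2 The bridge sum over a totally complex field, at every level -/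

section BridgeSum

variable {K : Type} [Field K] [NumberField K] {W : WeierstrassCurve K} {m : ℕ} [NeZero m]
variable {e : geomTorsion W ((m * m : ℕ) : ℤ) → geomTorsion W ((m * m : ℕ) : ℤ) → AlgebraicClosure K}
  {hμ : ∀ S T, e S T ^ (m * m) = 1}
  {hadd₁ : ∀ S₁ S₂ T, e (S₁ + S₂) T = e S₁ T * e S₂ T}
  {hadd₂ : ∀ S T₁ T₂, e S (T₁ + T₂) = e S T₁ * e S T₂}
  {hgal : ∀ (σ : absoluteGaloisGroup K) (S T : geomTorsion W ((m * m : ℕ) : ℤ)), σ • e S T = e (σ • S) (σ • T)}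
variable [Finite (geomTorsion W (m : ℤ))]

/-- **The bridge's idèle cocycle over a TOTALLY COMPLEX number field, at EVERY level `m`**: under `hPTc` for `f`, for
`h : N₁ → C̄` with `Ψ h = θ′_* [f]` and a locally trivial `γ`, the bridge's idèle `2`-cocycle `Z` (class image `h ∘ ∂γ`) has local
Brauer invariants vanishing off a finite set and SUMMING TO ZERO over the finite places, and every local class `(m·m)`-torsion —
VERBATIM cell bsd-wall's `ShaTwoCochain.exists_bridge_sum_localInvariants_eq_zero` (w3 g7) with its only use of `m` odd (the
archimedean members of THE canonical family vanish, `canonical_inl_eq_zero_of_odd`) replaced by their vanishing at the COMPLEX places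
(`canonical_inl_eq_zero_of_isComplex`). [cite: MilneADT2006, I Thm. 4.10 (a) (proof, pp. 57–58), §6 proof of Prop. 6.9]
[cite: CasselsFrohlichANT1967, Ch. VII §11.2 (bis)] -/
theorem exists_bridge_sum_localInvariants_eq_zero_of_isTotallyComplex [IsTotallyComplex K] [NeZero (m * m)]
    (hH3 : ∀ z : galoisCohomology (mu K (m * m)) 3, z = 0)
    {f : contTwoCocycles (W.torsionGaloisModule (m : ℤ)).toTopRep}
    (hf : ∀ g : contOneCocycles (W.torsionGaloisModule (m : ℤ)).toTopRep,
      (∀ v : Place K, locClass (W.torsionGaloisModule (m : ℤ)) (Place.Completion v)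
          (resOne (W.torsionGaloisModule (m : ℤ)) (Place.Completion v) g) = 0) →
      ∃ (C : PTChoice W m e hμ hadd₁ hadd₂ hgal f g) (S : Finset (Place K)),
        (∀ v ∉ S, C.localTerm (LocalInvariants.canonical K (m * m)) v = 0) ∧
          ∑ v ∈ S, C.localTerm (LocalInvariants.canonical K (m * m)) v = 0)
    (h : (presentationComplex (W.torsionGaloisModule (m : ℤ))).X₁ ⟶ classBarD K)
    (hh : shaTwoConnecting (W.torsionGaloisModule (m : ℤ)) (m * m)
        (FirstCaseData.mul_nsmul_geomTorsion_eq_zero (W := W) (m := m)) h =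
      galoisCohomology.map (pairingDualIntertwining
        (ρ₁ := W.torsionGaloisModule (m : ℤ)) (ρ₂ := W.torsionGaloisModule (m : ℤ))
        (B := (descendHom W m m e hμ hadd₁ hadd₂).flip) (ShaTwoCochainTheta.descendHom_flip_smul W m e hμ hadd₁ hadd₂ hgal)) 2
        (twoCocycleClass _ f))
    {γ : contOneCocycles (W.torsionGaloisModule (m : ℤ)).toTopRep}
    (hγ : ∀ v : Place K, locClass (W.torsionGaloisModule (m : ℤ)) (Place.Completion v)
      (resOne (W.torsionGaloisModule (m : ℤ)) (Place.Completion v) γ) = 0)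
    (πs : (v : Place K) → HomDual.IdeleProjection K v) :
    haveI := moduleFinite_presModule₁ (W.torsionGaloisModule (m : ℤ))
    haveI := absoluteGaloisGroup_compactSpace K
    ∃ (c : contTwoCocycles (presModule₁ (W.torsionGaloisModule (m : ℤ))).toTopRep)
      (ht : DiscreteRep.HomCarrier (LCarrier (presentationComplex (W.torsionGaloisModule (m : ℤ))).X₁) (LCarrier (ideleBarD K)))
      (Z : contTwoCocycles (toDGM (ideleBarD K)).toTopRep) (S' : Finset (Place K)),
      -- (3) `h̃` lifts `h`
      (∀ x : LCarrier (presentationComplex (W.torsionGaloisModule (m : ℤ))).X₁,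
        ideleToClassI K ((show _ →ₗ[ℤ] LCarrier (ideleBarD K) from ht) x) =
          lmap (presentationComplex (W.torsionGaloisModule (m : ℤ))).X₁ (classBarD K) h x) ∧
      -- (4) `[c] = δ₁[γ]`
      (pres_isSES (W.torsionGaloisModule (m : ℤ))).δ₁ (oneCocycleClass _ γ) = twoCocycleClass _ c ∧
      -- (5) `jC ∘ Z = h ∘ c`
      (∀ σ τ : absoluteGaloisGroup K,
        ideleToClassI K (Z.1 (σ, τ)) = lmap (presentationComplex (W.torsionGaloisModule (m : ℤ))).X₁ (classBarD K) h (c.1 (σ, τ))) ∧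
      -- (a) off `S'` the finite local invariants of `Z` vanish
      (∀ (v : HeightOneSpectrum (𝓞 K))
        (cZ : haveI := charZero_adicCompletion v; contTwoCocycles (units (v.adicCompletion K)).toTopRep),
        (∀ s t : absoluteGaloisGroup (v.adicCompletion K), cZ.1 (s, t) =
          ((πs (Sum.inr v)).toAddMonoidHom.comp (LCarrier.val (ideleBarD K)))
            (Z.1 (absGaloisRestrict K (v.adicCompletion K) s, absGaloisRestrict K (v.adicCompletion K) t))) →
        (Sum.inr v : Place K) ∉ S' →
        (haveI := charZero_adicCompletion v; haveI := absoluteGaloisGroup_compactSpace (v.adicCompletion K);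
          Prop121vii.brauerInvariantEquiv (v.adicCompletion K) (twoCocycleClass (units (v.adicCompletion K)).toTopRep cZ)) = 0) ∧
      -- (b) the finite-place sum of the local invariants of `Z` vanishes
      (∀ (T : Finset (HeightOneSpectrum (𝓞 K))), (∀ v : HeightOneSpectrum (𝓞 K), (Sum.inr v : Place K) ∈ S' → v ∈ T) →
        ∀ (cZs : (v : HeightOneSpectrum (𝓞 K)) →
            haveI := charZero_adicCompletion v; contTwoCocycles (units (v.adicCompletion K)).toTopRep),
          (∀ (v : HeightOneSpectrum (𝓞 K)) (s t : absoluteGaloisGroup (v.adicCompletion K)), (cZs v).1 (s, t) =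
            ((πs (Sum.inr v)).toAddMonoidHom.comp (LCarrier.val (ideleBarD K)))
              (Z.1 (absGaloisRestrict K (v.adicCompletion K) s, absGaloisRestrict K (v.adicCompletion K) t))) →
          ∑ v ∈ T, (haveI := charZero_adicCompletion v; haveI := absoluteGaloisGroup_compactSpace (v.adicCompletion K);
            Prop121vii.brauerInvariantEquiv (v.adicCompletion K)
              (twoCocycleClass (units (v.adicCompletion K)).toTopRep (cZs v))) = 0) ∧
      -- (c) every local class of `Z` is `(m·m)`-torsion
      (∀ (v : Place K) (cZ : contTwoCocycles (units (Place.Completion v)).toTopRep),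
        (∀ s t : absoluteGaloisGroup (Place.Completion v), cZ.1 (s, t) =
          ((πs v).toAddMonoidHom.comp (LCarrier.val (ideleBarD K)))
            (Z.1 (absGaloisRestrict K (Place.Completion v) s, absGaloisRestrict K (Place.Completion v) t))) →
        (haveI := absoluteGaloisGroup_compactSpace (Place.Completion v);
          (m * m) • twoCocycleClass (units (Place.Completion v)).toTopRep cZ) = 0) := by
  haveI := moduleFinite_presModule₁ (W.torsionGaloisModule (m : ℤ))
  haveI := moduleFinite_presModule₂ (W.torsionGaloisModule (m : ℤ))
  haveI := absoluteGaloisGroup_compactSpace K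
  -- the `μ`-currency bridge package
  obtain ⟨Fb, Hb, c, ht, Z, h1, h2, h3, h4, h5, h6⟩ := exists_bridgePackageMu (W.torsionGaloisModule (m : ℤ)) (m * m)
    (FirstCaseData.mul_nsmul_geomTorsion_eq_zero (W := W) (m := m)) hH3 h γ
  choose φb lam hφb h6b using h6
  -- glue-L: the canonical local terms of the bridge's choice `(H♭; φ♭_v)` have finite support and sum zero
  have hclass : galoisCohomology.map (pairingDualIntertwining
        (ρ₁ := W.torsionGaloisModule (m : ℤ)) (ρ₂ := W.torsionGaloisModule (m : ℤ))
        (B := (descendHom W m m e hμ hadd₁ hadd₂).flip) (ShaTwoCochainTheta.descendHom_flip_smul W m e hμ hadd₁ hadd₂ hgal)) 2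
        (twoCocycleClass _ f) = twoCocycleClass _ Fb := hh.symm.trans h1
  obtain ⟨S', hoff, hsum⟩ := ShaTwoCochainTheta.evFlip_support_and_sum_eq_zero_of_class_eq hf Fb hclass hγ Hb h2
    (fun v => φb v (πs v)) (fun v => hφb v (πs v))
  -- abbreviation: the canonical local term at `v`
  set t : (v : Place K) → ZMod (m * m) := fun v => LocalInvariants.canonical K (m * m) v
    (locClass₂ (mu K (m * m)) (Place.Completion v)
      ((((tateDualPairing (W.torsionGaloisModule (m : ℤ)) (m * m)).flip).restrict
          (absGaloisRestrict K (Place.Completion v))).cupSubCocycle (φb v (πs v))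
        (resOne (W.torsionGaloisModule (m : ℤ)) (Place.Completion v) γ)
        (resTwo ((W.torsionGaloisModule (m : ℤ)).tateDual (m * m)) (Place.Completion v) Fb) (hφb v (πs v))
        (resCochain₂ (Place.Completion v) Hb)
        (dTwo_resCochain₂_of_cupCocycle₂₁ ((tateDualPairing (W.torsionGaloisModule (m : ℤ)) (m * m)).flip)
          (fun v => ((tateDualPairing (W.torsionGaloisModule (m : ℤ)) (m * m)).flip).restrict
            (absGaloisRestrict K (Place.Completion v)))
          (fun _ _ _ => rfl) Hb h2 v))) with ht_def
  have hoff' : ∀ v ∉ S', t v = 0 := hoff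
  have hsum' : ∑ v ∈ S', t v = 0 := hsum
  -- the per-place join at a finite place
  have hjoin : ∀ (v : HeightOneSpectrum (𝓞 K))
      (cZ : haveI := charZero_adicCompletion v; contTwoCocycles (units (v.adicCompletion K)).toTopRep),
      (∀ s t : absoluteGaloisGroup (v.adicCompletion K), cZ.1 (s, t) =
        ((πs (Sum.inr v)).toAddMonoidHom.comp (LCarrier.val (ideleBarD K)))
          (Z.1 (absGaloisRestrict K (v.adicCompletion K) s, absGaloisRestrict K (v.adicCompletion K) t))) →
      (haveI := charZero_adicCompletion v; haveI := absoluteGaloisGroup_compactSpace (v.adicCompletion K);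
        Prop121vii.brauerInvariantEquiv (v.adicCompletion K) (twoCocycleClass (units (v.adicCompletion K)).toTopRep cZ)) =
        Prop121vii.zmodToQmodZ (m * m) (t (Sum.inr v)) := fun v cZ hcZ =>
    brauerInvariantEquiv_localProjection_eq_zmodToQmodZ_canonical (W.torsionGaloisModule (m : ℤ)) (m * m) v Fb γ Hb h2
      (φb (Sum.inr v) (πs (Sum.inr v))) (hφb (Sum.inr v) (πs (Sum.inr v))) (lam (Sum.inr v) (πs (Sum.inr v))) Z
      (πs (Sum.inr v)) cZ hcZ (h6b (Sum.inr v) (πs (Sum.inr v)))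
  refine ⟨c, ht, Z, S', h3, h4, h5, fun v cZ hcZ hv => ?_, fun T hT cZs hcZs => ?_, fun v cZ hcZ => ?_⟩
  · -- (a)
    rw [hjoin v cZ hcZ, hoff' _ hv, map_zero]
  · -- (b): `Σ_{v ∈ T} inv_v = zmodToQmodZ (Σ_{v ∈ T} t (inr v)) = zmodToQmodZ (Σ_{w ∈ S'} t w) = 0`
    rw [Finset.sum_congr rfl fun v _ => hjoin v (cZs v) (hcZs v), ← map_sum]
    have hTS : ∑ v ∈ T, t (Sum.inr v) = ∑ w ∈ S', t w := by
      have hmap : ∑ w ∈ T.map ⟨(Sum.inr : HeightOneSpectrum (𝓞 K) → Place K), Sum.inr_injective⟩, t w =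
          ∑ v ∈ T, t (Sum.inr v) := Finset.sum_map _ _ _
      rw [← hmap]
      -- both sums agree with the sum over the union (the extra terms vanish)
      rw [Finset.sum_subset (Finset.subset_union_right (s₁ := S')) fun w _ hw => ?_,
        Finset.sum_subset (Finset.subset_union_left (s₂ := T.map ⟨Sum.inr, Sum.inr_injective⟩)) fun w _ hw => hoff' w hw]
      -- `w ∈ S' ∪ T.map inr`, `w ∉ T.map inr`: then `t w = 0`
      rcases w with w | v
      · exact LocalInvariants.canonical_inl_eq_zero_of_isComplex (IsTotallyComplex.isComplex w) _
      · by_cases hv : (Sum.inr v : Place K) ∈ S'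
        · exact absurd (Finset.mem_map.2 ⟨v, hT v hv, rfl⟩) hw
        · exact hoff' _ hv
    rw [hTS, hsum', map_zero]
  · -- (c): `c_Z − dλ` has `μ_{m²}`-sourced values
    haveI := absoluteGaloisGroup_compactSpace (Place.Completion v)
    let z := (((tateDualPairing (W.torsionGaloisModule (m : ℤ)) (m * m)).flip).restrict
        (absGaloisRestrict K (Place.Completion v))).cupSubCocycle (φb v (πs v))
      (resOne (W.torsionGaloisModule (m : ℤ)) (Place.Completion v) γ)
      (resTwo ((W.torsionGaloisModule (m : ℤ)).tateDual (m * m)) (Place.Completion v) Fb) (hφb v (πs v))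
      (resCochain₂ (Place.Completion v) Hb)
      (dTwo_resCochain₂_of_cupCocycle₂₁ ((tateDualPairing (W.torsionGaloisModule (m : ℤ)) (m * m)).flip)
        (fun v => ((tateDualPairing (W.torsionGaloisModule (m : ℤ)) (m * m)).flip).restrict
          (absGaloisRestrict K (Place.Completion v)))
        (fun _ _ _ => rfl) Hb h2 v)
    let z' : contTwoCocycles (units (Place.Completion v)).toTopRep := cZ - (units (Place.Completion v)).twoCoboundary (lam v (πs v))
    have hz' : ∀ s t : absoluteGaloisGroup (Place.Completion v),
        z'.1 (s, t) = unitsTransferAddHom K (Place.Completion v) (kummerInclAddHom K (m * m) (z.1 (s, t))) := by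
      intro s t
      change cZ.1 (s, t) - ((units (Place.Completion v)).twoCoboundary (lam v (πs v))).1 (s, t) = _
      rw [hcZ, ContinuousRep.twoCoboundary_apply, ContPairing.cupSubCocycle_apply, ContPairing.restrict_toLin,
        ContPairing.flip_toLin_apply]
      exact (h6b v (πs v) s t).symm
    have hcl : twoCocycleClass (units (Place.Completion v)).toTopRep cZ = twoCocycleClass _ z' := by
      change _ = twoCocycleClass _ (cZ - (units (Place.Completion v)).twoCoboundary (lam v (πs v)))
      rw [twoCocycleClass_sub, ContinuousRep.twoCocycleClass_twoCoboundary, sub_zero]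
    have hz'0 : (m * m) • z' = 0 := by
      refine Subtype.ext (ContinuousMap.ext fun st => ?_)
      obtain ⟨s, t⟩ := st
      change (m * m) • z'.1 (s, t) = 0
      rw [hz', ← map_nsmul, ← map_nsmul, ← natCast_zsmul, zsmul_muCarrier_eq_zero, map_zero, map_zero]
    rw [hcl, ← twoCocycleClassₗ_apply, ← map_nsmul, hz'0, map_zero]

end BridgeSum

/-! ## §3 The readout vanishes on `Ш¹` over a totally complex field (w4 g2's assembly without `p ≠ 2`, any curve, any level) -/

section Readout

variable {K : Type} [Field K] [NumberField K] {W : WeierstrassCurve K} {m : ℕ} [NeZero m]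
variable {e : geomTorsion W ((m * m : ℕ) : ℤ) → geomTorsion W ((m * m : ℕ) : ℤ) → AlgebraicClosure K}
  {hμ : ∀ S T, e S T ^ (m * m) = 1}
  {hadd₁ : ∀ S₁ S₂ T, e (S₁ + S₂) T = e S₁ T * e S₂ T}
  {hadd₂ : ∀ S T₁ T₂, e S (T₁ + T₂) = e S T₁ * e S T₂}
  {hgal : ∀ (σ : absoluteGaloisGroup K) (S T : geomTorsion W ((m * m : ℕ) : ℤ)), σ • e S T = e (σ • S) (σ • T)}
variable [Finite (geomTorsion W (m : ℤ))]

/-- **Road B's readout `classBarInv(Φ⁻¹[γ] ∘ ∂h)` vanishes for every `y = [γ] ∈ Ш¹(K, E[m])`**, `K` totally complex, EVERY level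
`m`, every elliptic `E/K`: given `hPTc`'s hypothesis for `f` and `Ψ h = θ′_* [f]`. §2 (THE idèle projections) gives `Z, c, h̃` with
(3)(4)(5), vanishing finite-place invariant sums on large `T` and `(m·m)`-torsion local classes; the archimedean classes vanish
because every infinite place is complex (§1); then w3 g8's criterion `ShaTwoCochain.classBarInv_readout_eq_zero_of_criterion`.
[cite: MilneADT2006, Ch. I Thm. 4.10 (a) (proof, pp. 57–58), Lemma 4.13][cite: CasselsFrohlichANT1967, Ch. VII §11.2 (bis)] -/
theorem readout_eq_zero_of_isTotallyComplex [IsTotallyComplex K] [NeZero (m * m)]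
    {f : contTwoCocycles (W.torsionGaloisModule (m : ℤ)).toTopRep}
    (hf : ∀ g : contOneCocycles (W.torsionGaloisModule (m : ℤ)).toTopRep,
      (∀ v : Place K, locClass (W.torsionGaloisModule (m : ℤ)) (Place.Completion v)
          (resOne (W.torsionGaloisModule (m : ℤ)) (Place.Completion v) g) = 0) →
      ∃ (C : PTChoice W m e hμ hadd₁ hadd₂ hgal f g) (S : Finset (Place K)),
        (∀ v ∉ S, C.localTerm (LocalInvariants.canonical K (m * m)) v = 0) ∧
          ∑ v ∈ S, C.localTerm (LocalInvariants.canonical K (m * m)) v = 0)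
    (h : (presentationComplex (W.torsionGaloisModule (m : ℤ))).X₁ ⟶ classBarD K)
    (hh : shaTwoConnecting (W.torsionGaloisModule (m : ℤ)) (m * m)
        (FirstCaseData.mul_nsmul_geomTorsion_eq_zero (W := W) (m := m)) h =
      galoisCohomology.map (pairingDualIntertwining
        (ρ₁ := W.torsionGaloisModule (m : ℤ)) (ρ₂ := W.torsionGaloisModule (m : ℤ))
        (B := (descendHom W m m e hμ hadd₁ hadd₂).flip) (ShaTwoCochainTheta.descendHom_flip_smul W m e hμ hadd₁ hadd₂ hgal)) 2
        (twoCocycleClass _ f))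
    (y : galoisCohomology (W.torsionGaloisModule (m : ℤ)) 1) (hy : y ∈ sha (W.torsionGaloisModule (m : ℤ))) :
    classBarInv K (((extOneEquiv (W.torsionGaloisModule (m : ℤ))).symm y).comp
      (boundary (presentationComplex_shortExact (W.torsionGaloisModule (m : ℤ))) (classBarD K) h) (rfl : 1 + 1 = 2)) = 0 := by
  haveI := absoluteGaloisGroup_compactSpace K
  have hH3 : ∀ z : galoisCohomology (mu K (m * m)) 3, z = 0 := galoisCohomology_three_mu_eq_zero_of_isTotallyComplex' K (m * m)
  -- a cocycle `γ ∈ y`, locally trivial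
  obtain ⟨γ, rfl⟩ := oneCocycleClass_surjective _ y
  have hγ := (oneCocycleClass_mem_sha_iff_locClass (W.torsionGaloisModule (m : ℤ)) γ).1 hy
  -- the bridge sum package for THE idèle projections (§2)
  obtain ⟨c, ht, Z, S', h3, h4, h5, -, hb, hc⟩ :=
    exists_bridge_sum_localInvariants_eq_zero_of_isTotallyComplex (hgal := hgal) hH3 hf h hh hγ
      fun v => IdeleReadout.ideleProjection K v
  -- the local projection cocycles at the finite places
  choose cZ hcZ using fun v : HeightOneSpectrum (𝓞 K) =>
    exists_localProjectionCocycle Z (Sum.inr v) (IdeleReadout.ideleProjection K (Sum.inr v))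
  -- the archimedean classes vanish: every infinite place is complex
  have hinf : ∀ (w : InfinitePlace K) (cW : contTwoCocycles (units (Place.Completion (Sum.inl w : Place K))).toTopRep),
      (∀ s t : absoluteGaloisGroup (Place.Completion (Sum.inl w : Place K)),
        cW.1 (s, t) = ((IdeleReadout.ideleProjection K (Sum.inl w)).toAddMonoidHom.comp (LCarrier.val (ideleBarD K)))
          (Z.1 (absGaloisRestrict K (Place.Completion (Sum.inl w : Place K)) s,
            absGaloisRestrict K (Place.Completion (Sum.inl w : Place K)) t))) →
      (haveI := absoluteGaloisGroup_compactSpace (Place.Completion (Sum.inl w : Place K));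
        twoCocycleClass (units (Place.Completion (Sum.inl w : Place K))).toTopRep cW) = 0 := fun w cW _ =>
    twoCocycleClass_eq_zero_of_isComplex w (IsTotallyComplex.isComplex w) _ cW
  -- the criterion: the finite-place invariant sums vanish over every `T ⊇ S′ ∩ {finite}` by (b)
  exact ShaTwoCochain.classBarInv_readout_eq_zero_of_criterion K (m * m) (W.torsionGaloisModule (m : ℤ))
    (FirstCaseData.mul_nsmul_geomTorsion_eq_zero (W := W) (m := m)) h γ c ht Z h3 h4 h5 cZ hcZ hinf
    ⟨S'.toRight, fun T hT => hb T (fun v hv => hT (Finset.mem_toRight.2 hv)) cZ hcZ⟩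

end Readout

/-! ## §4 `hPTc` for THE maps at every level over a totally complex field -/

section PTc

variable {K : Type} [Field K] [NumberField K] (W : WeierstrassCurve K) [W.IsElliptic] (m : ℕ) [NeZero m]
variable (e : geomTorsion W ((m * m : ℕ) : ℤ) → geomTorsion W ((m * m : ℕ) : ℤ) → AlgebraicClosure K)
  (hμ : ∀ S T, e S T ^ (m * m) = 1)
  (hadd₁ : ∀ S₁ S₂ T, e (S₁ + S₂) T = e S₁ T * e S₂ T)
  (hadd₂ : ∀ S T₁ T₂, e S (T₁ + T₂) = e S T₁ * e S T₂)
  (hgal : ∀ (σ : absoluteGaloisGroup K) (S T : geomTorsion W ((m * m : ℕ) : ℤ)), σ • e S T = e (σ • S) (σ • T))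
  (halt : ∀ T, e T T = 1) (hnd : ∀ T, (∀ S, e S T = 1) → T = 0)

include halt hnd in
/-- **Milne I Thm. 4.10 (a) for `Ш²(K, E[m])` in the `PTChoice` cochain form (`hPTc`) for THE canonical invariant maps, at EVERY
level `m ≥ 1`, over a TOTALLY COMPLEX number field `K`, for every elliptic curve `E/K`** and every Weil-type alternating
non-degenerate pairing `e` on `E[m²]`: if for every locally trivial `1`-cocycle `g` of `E[m]` there is an admissible choice for
`(f, g)` whose canonical local terms are finitely supported and sum to zero, then `[f] = 0` in `H²(K, E[m])`. Proof: the Shell's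
flipped exhaustion (`PTChoice.twoCocycleClass_eq_zero_of_shaTwoConnecting_eq_zero_flip`) and readout-vanishing
(`shaTwoConnecting_eq_zero_of_forall_sha_classBarInv_extOneEquiv_symm_eq_zero`, a biduality pair from `exists_bidual_intertwining`),
with the readout killed by §3. This is the input `hPTc` of the tree's `isLevelPairing_ctLevelPairing_of_inputs`.
[cite: MilneADT2006, Ch. I Thm. 4.10 (a) (proof, pp. 57–58), Lemma 4.13, §6 Thm. 6.13 (a)][cite: CasselsFrohlichANT1967, Ch. VII §11.2 (bis)] -/
theorem hPTc_canonical_of_isTotallyComplex [IsTotallyComplex K]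
    (f : contTwoCocycles (W.torsionGaloisModule (m : ℤ)).toTopRep)
    (hf : ∀ g : contOneCocycles (W.torsionGaloisModule (m : ℤ)).toTopRep,
      (∀ v : Place K, locClass (W.torsionGaloisModule (m : ℤ)) (Place.Completion v)
          (resOne (W.torsionGaloisModule (m : ℤ)) (Place.Completion v) g) = 0) →
      ∃ (C : PTChoice W m e hμ hadd₁ hadd₂ hgal f g) (S : Finset (Place K)),
        (∀ v ∉ S, C.localTerm (LocalInvariants.canonical K (m * m)) v = 0) ∧
          ∑ v ∈ S, C.localTerm (LocalInvariants.canonical K (m * m)) v = 0) :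
    twoCocycleClass _ f = 0 := by
  haveI : NeZero (m * m) := ⟨mul_ne_zero (NeZero.ne _) (NeZero.ne _)⟩
  haveI : Finite (geomTorsion W (m : ℤ)) := finite_geomTorsion_of_neZero W m
  haveI : Finite (TateDual K (geomTorsion W (m : ℤ)) (m * m)) := DiscreteGaloisModule.TateDual.finite K _ _
  obtain ⟨C, -, -⟩ := hf 0 fun v => locClass_resOne_zero _ v
  obtain ⟨ι, κ, hι, hκι, hικ⟩ := exists_bidual_intertwining (n := m * m) (W.torsionGaloisModule (m : ℤ))
    (FirstCaseData.mul_nsmul_geomTorsion_eq_zero (W := W) (m := m))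
  exact C.twoCocycleClass_eq_zero_of_shaTwoConnecting_eq_zero_flip
    (FirstCaseData.mul_nsmul_geomTorsion_eq_zero (W := W) (m := m)) halt hnd
    fun h hh => shaTwoConnecting_eq_zero_of_forall_sha_classBarInv_extOneEquiv_symm_eq_zero _ _ ι κ hι hκι hικ h
      fun y hy => readout_eq_zero_of_isTotallyComplex (hgal := hgal) hf h hh y hy

end PTc

end Summit.BirchSwinnertonDyer.BirchSwinnertonDyer.Theorems.GenusExact.CasselsTatePTc

end
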